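import Mathlib
import Summits.Ventures.HodgeRepro.PeriodCloserC7Stability
import Summits.Ventures.HodgeRepro.OcticCMPointS3

/-!
# OcticCMPointTruncModel — the rings `𝒪/𝔭^c`, `2 ≤ c ≤ 4`, at the ramified places `𝔭₁, 𝔭₂ | 5`, transcribed

Blind re-derivation cell `pub-hodge-repro`, seat night-2 (gen 4).  Target tree path
`lean/Summits/Ventures/HodgeRepro/OcticCMPointTruncModel.lean`.  Companion of `OcticCMPointDualModel.lean`
(the case `c = 2`); here EVERY conductor `c` with `𝒪/𝔭^c` a `𝔽₅`-algebra.

**The transcription.**  At `𝔭₁, 𝔭₂ | 5` of `E = ℚ(ζ₅, √(4+√5))` the completion `K_v = ℚ₅(ζ₅)` is totally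
ramified of degree `4` over `ℚ₅` (`OcticCMPointS3.lean`: `octic_p1 = ⟨5, 2, 1, 5, 5⟩`) with the trace-zero
uniformiser `ϖ = ζ₅ − ζ₅⁻¹` (`σ ϖ = −ϖ`) and residue field `𝔽₅`; since `5 ∈ 𝔭⁴`, for `c ≤ 4` the ring
`𝒪/𝔭^c` has characteristic `5` and is `𝔽₅[ϖ]/(ϖ^c)` — Mathlib's `AdjoinRoot (X ^ c)` over `ZMod 5`
(`Trunc k c` below, `k` any finite field) — with `σ` acting by `ϖ ↦ −ϖ` on the Teichmüller coefficients.

The hypotheses of the gen-1 / gen-3 model theorems (`PeriodCloserC7Stability.lean` `eps_mul_eq` / `eps_E3_of_N2`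
with `I = 𝔪`; `GaussSumProductLocal.lean` / `OcticCMPointDeepSign.lean` with `hloc`, `hA`, `hsq`;
`OcticCMPointConjDual.lean` `conjDual_ramified`) become THEOREMS of `Trunc k c`: the maximal ideal
`maxIdeal c = (ϖ)` with `hloc` (`x ∈ 𝔪 ↔ ¬ IsUnit x`: a non-unit is `ϖ · y`, nilpotent; a unit is
`a + ϖ y`, `a ≠ 0`, unit plus nilpotent); the induced additive character `psiTilde c ψ₀ : x ↦ ψ₀(x_{c−1})`
(the top coefficient of the representative of degree `< c`, `AdjoinRoot.modByMonicHom`), PRIMITIVE when `ψ₀`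
is (`psiTilde_isPrimitive`: shift a non-zero `x` by `t ϖ^{c−1−j}`, `j` its trailing degree); its
`𝔪`-annihilator lies in the socle `(ϖ^{c−1})` (`exists_of_psiAnn`), whence `hA` (`c ≥ 2`) and `hsq`
(`2c − 2 ≥ c`); the conjugation `conj c : ϖ ↦ −ϖ` as a ring automorphism, with
`ψ̃ ∘ σ = ψ̃ ∘ ((−1)^{c−1} ·)` (`psiTilde_conj`) = the hypothesis of `conjDual_ramified` for `n ≡ c (mod 2)`
(`psiTilde_conj_pow`; `n = ν + c` with `ν(ψ_δ)` even, gen 3 `NIGHT-2-g3.md` §3c); and `|Trunc k c| = |k|^c`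
(`card_trunc`, `card_trunc_p5`: `5^c = q_K^c` at `𝔭₁, 𝔭₂`).

**What this is not.**  For `c ≥ 5` the ring `𝒪/𝔭^c` is a `ℤ/5^{⌈c/4⌉}`-algebra, not a `𝔽₅`-algebra, and is
not transcribed; the characters of `(𝒪/𝔭^c)^×` are not enumerated and no Gauss sum is evaluated here
(`c = 2`: `OcticCMPointDualModel.lean`).  Nothing here says anything about the status of the Hodge conjecture
for CM abelian varieties, which is NOT proved.
-/

set_option autoImplicit false

noncomputable section

open Finset Polynomial

namespace Summit.Ventures.HodgeRepro.PeriodCloser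

open GaussSumStability

namespace TruncModel

variable {k : Type} [Field k]

/-- **The ring `k[ϖ]/(ϖ^c)`** (`𝒪/𝔭^c` for `c ≤ e(K_v/ℚ_p)`). -/
abbrev Trunc (k : Type) [Field k] (c : ℕ) : Type := AdjoinRoot (X ^ c : k[X])

variable (c : ℕ)

/-- The class of the uniformiser `ϖ`. -/
abbrev varpi : Trunc k c := AdjoinRoot.root (X ^ c : k[X])

/-- The quotient map `k[X] → k[ϖ]/(ϖ^c)`. -/
abbrev mk : k[X] →+* Trunc k c := AdjoinRoot.mk (X ^ c : k[X])

/-- `ϖ^c = 0`. -/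
theorem varpi_pow_c : (varpi c : Trunc k c) ^ c = 0 := by
  rw [varpi, ← AdjoinRoot.mk_X, ← map_pow, AdjoinRoot.mk_self]

/-- `X^c ≠ 1` for `c > 0`. -/
theorem X_pow_ne_one (hc : 0 < c) : (X ^ c : k[X]) ≠ 1 := by
  intro h
  have := congrArg natDegree h
  rw [natDegree_X_pow, natDegree_one] at this
  omega

/-- `k[ϖ]/(ϖ^c)` is non-trivial for `c > 0`. -/
theorem nontrivial (hc : 0 < c) : Nontrivial (Trunc k c) :=
  AdjoinRoot.nontrivial (X ^ c : k[X]) (by rw [degree_X_pow]; exact_mod_cast hc.ne')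

/-! ### Coefficients of the representative of degree `< c` -/

/-- **The `i`-th coefficient** of the representative of degree `< c` (`AdjoinRoot.modByMonicHom`), a
`k`-linear map `k[ϖ]/(ϖ^c) → k`. -/
def coeffAt (i : ℕ) : Trunc k c →ₗ[k] k :=
  (lcoeff k i).comp (AdjoinRoot.modByMonicHom (monic_X_pow c))

/-- `coeffAt c i (mk p) = (p %ₘ X^c).coeff i`. -/
theorem coeffAt_mk (p : k[X]) (i : ℕ) : coeffAt c i (mk c p) = (p %ₘ X ^ c).coeff i := by
  simp only [coeffAt, LinearMap.comp_apply, AdjoinRoot.modByMonicHom_mk, lcoeff_apply]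

/-- Reduction modulo `X^c` does not change the coefficients below `c`. -/
theorem coeff_modByMonic_X_pow (p : k[X]) {i : ℕ} (hi : i < c) : (p %ₘ X ^ c).coeff i = p.coeff i := by
  have h := congrArg (fun q : k[X] => q.coeff i) (modByMonic_add_div p (X ^ c))
  simp only [coeff_add] at h
  rw [coeff_X_pow_mul', if_neg (not_le.2 hi), add_zero] at h
  exact h

/-- `coeffAt c i (mk p) = p.coeff i` for `i < c`. -/
theorem coeffAt_mk_of_lt (p : k[X]) {i : ℕ} (hi : i < c) : coeffAt c i (mk c p) = p.coeff i := by
  rw [coeffAt_mk, coeff_modByMonic_X_pow c p hi]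

/-- `c − 1 < c` for `c > 0`. -/
theorem sub_one_lt (hc : 0 < c) : c - 1 < c := Nat.sub_lt hc one_pos

/-! ### The maximal ideal `𝔪 = (ϖ)` and the local-ring hypothesis -/

/-- **The maximal ideal** `𝔪 = (ϖ)` of `k[ϖ]/(ϖ^c)` (the transcription of `𝔭/𝔭^c`). -/
def maxIdeal : Ideal (Trunc k c) := Ideal.span {varpi c}

/-- `x ∈ 𝔪 ↔ x₀ = 0` (`c > 0`). -/
theorem mem_maxIdeal_iff_coeff (hc : 0 < c) (x : Trunc k c) : x ∈ maxIdeal c ↔ coeffAt c 0 x = 0 := by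
  constructor
  · intro hx
    obtain ⟨y, rfl⟩ := Ideal.mem_span_singleton.1 hx
    obtain ⟨q, rfl⟩ := AdjoinRoot.mk_surjective y
    rw [show (varpi c : Trunc k c) * mk c q = mk c (X * q) by rw [map_mul, AdjoinRoot.mk_X],
      coeffAt_mk_of_lt c _ hc, coeff_X_mul_zero]
  · intro h0
    obtain ⟨p, rfl⟩ := AdjoinRoot.mk_surjective x
    rw [coeffAt_mk_of_lt c p hc] at h0
    rw [maxIdeal, Ideal.mem_span_singleton]
    refine ⟨mk c (divX p), ?_⟩
    conv_lhs => rw [← X_mul_divX_add p, h0, C_0, add_zero]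
    rw [map_mul, AdjoinRoot.mk_X]

/-- Elements of `𝔪` are nilpotent: `(ϖ y)^c = ϖ^c y^c = 0`. -/
theorem isNilpotent_of_mem {x : Trunc k c} (hx : x ∈ maxIdeal c) : IsNilpotent x := by
  obtain ⟨y, rfl⟩ := Ideal.mem_span_singleton.1 hx
  exact ⟨c, by rw [mul_pow, varpi_pow_c, zero_mul]⟩

/-- **`hloc`**: `k[ϖ]/(ϖ^c)` is local with maximal ideal `𝔪` — `x ∈ 𝔪 ↔ ¬ IsUnit x` (`c > 0`): a non-unit
is nilpotent; off `𝔪`, `x = a + ϖ y` with `a ≠ 0` is a unit plus a nilpotent. -/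
theorem hloc (hc : 0 < c) (x : Trunc k c) : x ∈ maxIdeal c ↔ ¬ IsUnit x := by
  haveI := nontrivial (k := k) c hc
  constructor
  · intro hx hu
    exact hu.not_isNilpotent (isNilpotent_of_mem c hx)
  · intro hu
    by_contra hx
    apply hu
    rw [mem_maxIdeal_iff_coeff c hc] at hx
    obtain ⟨p, rfl⟩ := AdjoinRoot.mk_surjective x
    rw [coeffAt_mk_of_lt c p hc] at hx
    have hp : mk c p = varpi c * mk c (divX p) + AdjoinRoot.of (X ^ c : k[X]) (p.coeff 0) := by
      conv_lhs => rw [← X_mul_divX_add p]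
      rw [map_add, map_mul, AdjoinRoot.mk_X, AdjoinRoot.mk_C]
    rw [hp]
    refine IsNilpotent.isUnit_add_right_of_commute ?_ ?_ (Commute.all _ _)
    · exact ⟨c, by rw [mul_pow, varpi_pow_c, zero_mul]⟩
    · exact (isUnit_iff_ne_zero.2 hx).map (AdjoinRoot.of (X ^ c : k[X]))

/-! ### The induced additive character `ψ̃(x) = ψ₀(x_{c−1})` -/

/-- **The induced additive character** `ψ̃ : k[ϖ]/(ϖ^c) → ℂ^×`, `x ↦ ψ₀(x_{c−1})` (the transcription of
`ψ̃(y) = ψ_δ(ϖ^{−n} y)` on `𝒪/𝔭^c`: it factors through the top coefficient, i.e. through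
`𝒪/𝔭^c → 𝔭^{c−1}/𝔭^c` after projecting away the lower ones, and is non-trivial on the socle). -/
def psiTilde (ψ₀ : AddChar k ℂ) : AddChar (Trunc k c) ℂ :=
  ψ₀.compAddMonoidHom (coeffAt c (c - 1)).toAddMonoidHom

/-- `ψ̃(x) = ψ₀(x_{c−1})`. -/
theorem psiTilde_apply (ψ₀ : AddChar k ℂ) (x : Trunc k c) : psiTilde c ψ₀ x = ψ₀ (coeffAt c (c - 1) x) := rfl

/-- `ψ̃(mk p) = ψ₀(p_{c−1})` (`c > 0`). -/
theorem psiTilde_mk (hc : 0 < c) (ψ₀ : AddChar k ℂ) (p : k[X]) :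
    psiTilde c ψ₀ (mk c p) = ψ₀ (p.coeff (c - 1)) := by
  rw [psiTilde_apply, coeffAt_mk_of_lt c p (sub_one_lt c hc)]

/-- The top coefficient of `p · (t ϖ^{c−1−j})` is `p_j t` when `j ≤ c − 1`. -/
theorem coeff_mul_C_mul_X_pow (p : k[X]) (t : k) {j : ℕ} (hj : j ≤ c - 1) :
    (p * (C t * X ^ (c - 1 - j))).coeff (c - 1) = p.coeff j * t := by
  rw [← mul_assoc, coeff_mul_X_pow', if_pos (Nat.sub_le _ _), show c - 1 - (c - 1 - j) = j by omega,
    coeff_mul_C]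

/-- The representative of degree `< c` of `a`: `mk p = a`, `natDegree p < c` (`c > 0`). -/
theorem exists_rep (hc : 0 < c) (a : Trunc k c) : ∃ p : k[X], mk c p = a ∧ p.natDegree < c := by
  obtain ⟨q, rfl⟩ := AdjoinRoot.mk_surjective a
  refine ⟨q %ₘ X ^ c, AdjoinRoot.mk_leftInverse (monic_X_pow c) (mk c q), ?_⟩
  have := natDegree_modByMonic_lt q (monic_X_pow c) (X_pow_ne_one c hc)
  rwa [natDegree_X_pow] at this

/-- **`ψ̃` is primitive when `ψ₀` is** (`c > 0`): for `a ≠ 0` with representative `p` of trailing degree `j`,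
the shift by `t ϖ^{c−1−j}` has `ψ̃(a · t ϖ^{c−1−j}) = ψ₀(p_j t)`, non-trivial in `t`. -/
theorem psiTilde_isPrimitive (hc : 0 < c) (ψ₀ : AddChar k ℂ) (h₀ : ψ₀.IsPrimitive) :
    (psiTilde c ψ₀).IsPrimitive := by
  intro a ha h1
  obtain ⟨p, hpa, hpdeg⟩ := exists_rep c hc a
  have hp0 : p ≠ 0 := by
    rintro rfl
    rw [map_zero] at hpa
    exact ha hpa.symm
  have hj : p.natTrailingDegree ≤ c - 1 := (natTrailingDegree_le_natDegree p).trans (Nat.le_sub_one_of_lt hpdeg)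
  have hpj : p.coeff p.natTrailingDegree ≠ 0 := trailingCoeff_nonzero_iff_nonzero.2 hp0
  apply h₀ hpj
  ext t
  rw [AddChar.mulShift_apply, AddChar.one_apply]
  have key := DFunLike.congr_fun h1 (mk c (C t * X ^ (c - 1 - p.natTrailingDegree)))
  rw [AddChar.mulShift_apply, AddChar.one_apply, ← hpa, ← map_mul, psiTilde_mk c hc,
    coeff_mul_C_mul_X_pow c p t hj] at key
  exact key

/-! ### The `ψ̃`-annihilator of `𝔪` lies in the socle `(ϖ^{c−1})` -/

/-- `t ϖ^{c−1−j} ∈ 𝔪` when `j < c − 1`. -/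
theorem mk_C_mul_X_pow_mem (t : k) {j : ℕ} (hj : j < c - 1) : mk c (C t * X ^ (c - 1 - j)) ∈ maxIdeal c := by
  rw [maxIdeal, Ideal.mem_span_singleton]
  refine ⟨mk c (C t * X ^ (c - 2 - j)), ?_⟩
  rw [varpi, ← AdjoinRoot.mk_X, ← map_mul]
  congr 1
  rw [show c - 1 - j = (c - 2 - j) + 1 by omega, pow_succ]
  ring

/-- **The annihilator lies in the socle** (`c > 0`, `ψ₀` primitive): if `ψ̃(t z) = 1` for all `z ∈ 𝔪`, then
every coefficient of `t` below `c − 1` vanishes (else shift by `s ϖ^{c−1−j}`, `j` the trailing degree), so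
`t = ϖ^{c−1} y`. -/
theorem exists_of_psiAnn (hc : 0 < c) (ψ₀ : AddChar k ℂ) (h₀ : ψ₀.IsPrimitive) (t : Trunc k c)
    (ht : PsiAnn (psiTilde c ψ₀) (maxIdeal c) t) : ∃ y, t = varpi c ^ (c - 1) * y := by
  obtain ⟨p, rfl, -⟩ := exists_rep c hc t
  have hcoeff : ∀ i < c - 1, p.coeff i = 0 := by
    intro i hi
    by_contra hne
    have hj : p.natTrailingDegree ≤ i := natTrailingDegree_le_of_ne_zero hne
    have hp0 : p ≠ 0 := fun h => hne (by rw [h, coeff_zero])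
    have hpj : p.coeff p.natTrailingDegree ≠ 0 := trailingCoeff_nonzero_iff_nonzero.2 hp0
    apply h₀ hpj
    ext s
    rw [AddChar.mulShift_apply, AddChar.one_apply]
    have key := ht _ (mk_C_mul_X_pow_mem c s (lt_of_le_of_lt hj hi))
    rw [← map_mul, psiTilde_mk c hc, coeff_mul_C_mul_X_pow c p s (by omega)] at key
    exact key
  obtain ⟨r, hr⟩ := X_pow_dvd_iff.2 hcoeff
  exact ⟨mk c r, by rw [hr, map_mul, map_pow, AdjoinRoot.mk_X]⟩

/-- **`hA`** (`c ≥ 2`): the annihilator lies in `𝔪`. -/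
theorem hA (hc : 2 ≤ c) (ψ₀ : AddChar k ℂ) (h₀ : ψ₀.IsPrimitive) :
    ∀ t, PsiAnn (psiTilde c ψ₀) (maxIdeal c) t → t ∈ maxIdeal c := by
  intro t ht
  obtain ⟨y, rfl⟩ := exists_of_psiAnn c (by omega) ψ₀ h₀ t ht
  rw [maxIdeal, Ideal.mem_span_singleton]
  exact ⟨varpi c ^ (c - 2) * y, by rw [← mul_assoc, ← pow_succ', show c - 2 + 1 = c - 1 by omega]⟩

/-- **`hsq`** (`c ≥ 2`): the annihilator has square zero, `ϖ^{2c−2} = 0`. -/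
theorem hsq (hc : 2 ≤ c) (ψ₀ : AddChar k ℂ) (h₀ : ψ₀.IsPrimitive) :
    ∀ t t', PsiAnn (psiTilde c ψ₀) (maxIdeal c) t → PsiAnn (psiTilde c ψ₀) (maxIdeal c) t' → t * t' = 0 := by
  intro t t' ht ht'
  obtain ⟨y, rfl⟩ := exists_of_psiAnn c (by omega) ψ₀ h₀ t ht
  obtain ⟨y', rfl⟩ := exists_of_psiAnn c (by omega) ψ₀ h₀ t' ht'
  have h : (varpi c : Trunc k c) ^ (c - 1) * (varpi c ^ (c - 1)) = 0 := by
    rw [← pow_add, show c - 1 + (c - 1) = c + (c - 2) by omega, pow_add, varpi_pow_c, zero_mul]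
  calc varpi c ^ (c - 1) * y * (varpi c ^ (c - 1) * y') = varpi c ^ (c - 1) * varpi c ^ (c - 1) * (y * y') := by
        ring
    _ = 0 := by rw [h, zero_mul]

/-- The hypothesis `hI` of `eps_mul_eq` / `eps_E3_of_N2` (`PeriodCloserC7Stability.lean`) for the socle
`I = (ϖ^{c−1})`, `c ≥ 2`: `I · I = 0`. -/
theorem socle_mul_eq_zero (hc : 2 ≤ c) : ∀ z ∈ Ideal.span {(varpi c : Trunc k c) ^ (c - 1)},
    ∀ z' ∈ Ideal.span {(varpi c : Trunc k c) ^ (c - 1)}, z * z' = 0 := by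
  intro z hz z' hz'
  obtain ⟨y, rfl⟩ := Ideal.mem_span_singleton.1 hz
  obtain ⟨y', rfl⟩ := Ideal.mem_span_singleton.1 hz'
  have h : (varpi c : Trunc k c) ^ (c - 1) * (varpi c ^ (c - 1)) = 0 := by
    rw [← pow_add, show c - 1 + (c - 1) = c + (c - 2) by omega, pow_add, varpi_pow_c, zero_mul]
  calc varpi c ^ (c - 1) * y * (varpi c ^ (c - 1) * y') = varpi c ^ (c - 1) * varpi c ^ (c - 1) * (y * y') := by
        ring
    _ = 0 := by rw [h, zero_mul]

/-! ### The conjugation `σ : ϖ ↦ −ϖ` -/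

/-- `(−ϖ)^c = 0`: `−ϖ` is a root of `X^c`. -/
theorem eval₂_neg_varpi : (X ^ c : k[X]).eval₂ (AdjoinRoot.of (X ^ c : k[X])) (-varpi c) = 0 := by
  rw [eval₂_X_pow, neg_pow, varpi_pow_c, mul_zero]

/-- **The conjugation** as a ring homomorphism: `ϖ ↦ −ϖ`, identity on the coefficients. -/
def conjHom : Trunc k c →+* Trunc k c :=
  AdjoinRoot.lift (AdjoinRoot.of (X ^ c : k[X])) (-varpi c) (eval₂_neg_varpi c)

/-- `σ(mk p) = p(−ϖ)`. -/
theorem conjHom_mk (p : k[X]) : conjHom c (mk c p) = p.eval₂ (AdjoinRoot.of (X ^ c : k[X])) (-varpi c) :=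
  AdjoinRoot.lift_mk _ _

/-- `σ ϖ = −ϖ`. -/
theorem conjHom_varpi : conjHom c (varpi c : Trunc k c) = -varpi c := AdjoinRoot.lift_root _

/-- `σ` fixes the coefficients. -/
theorem conjHom_of (a : k) : conjHom c (AdjoinRoot.of (X ^ c : k[X]) a) = AdjoinRoot.of (X ^ c : k[X]) a :=
  AdjoinRoot.lift_of _

/-- `σ ∘ σ = id`. -/
theorem conjHom_conjHom (x : Trunc k c) : conjHom c (conjHom c x) = x := by
  induction x using AdjoinRoot.induction_on with
  | ih p =>
    rw [conjHom_mk, Polynomial.hom_eval₂, map_neg, conjHom_varpi, neg_neg]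
    have h : (conjHom c).comp (AdjoinRoot.of (X ^ c : k[X])) = AdjoinRoot.of (X ^ c : k[X]) :=
      RingHom.ext (conjHom_of c)
    rw [h, ← AdjoinRoot.aeval_eq, aeval_def, AdjoinRoot.algebraMap_eq]

/-- **The conjugation** of `𝒪/𝔭^c` for a trace-zero uniformiser, as a ring automorphism. -/
def conj : Trunc k c ≃+* Trunc k c :=
  RingEquiv.ofRingHom (conjHom c) (conjHom c) (RingHom.ext (conjHom_conjHom c))
    (RingHom.ext (conjHom_conjHom c))

/-- `conj c x = conjHom c x`. -/
theorem conj_apply (x : Trunc k c) : conj c x = conjHom c x := rfl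

/-- `coeffAt` of a scalar multiple `algebraMap r * x`. -/
theorem coeffAt_algebraMap_mul (i : ℕ) (r : k) (x : Trunc k c) :
    coeffAt c i (algebraMap k (Trunc k c) r * x) = r * coeffAt c i x := by
  rw [← Algebra.smul_def, map_smul, smul_eq_mul]

/-- **The top coefficient of `σ x`**: `(σ x)_{c−1} = (−1)^{c−1} x_{c−1}` (`c > 0`; by induction on the
representative, monomial by monomial: `σ(a ϖ^i) = (−1)^i a ϖ^i`). -/
theorem coeffAt_conjHom (hc : 0 < c) (x : Trunc k c) :
    coeffAt c (c - 1) (conjHom c x) = (-1) ^ (c - 1) * coeffAt c (c - 1) x := by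
  induction x using AdjoinRoot.induction_on with
  | ih p =>
    induction p using Polynomial.induction_on' with
    | add p q hp hq => rw [map_add, map_add, map_add, hp, hq, map_add, mul_add]
    | monomial i a =>
      have hm : mk c (monomial i a) = AdjoinRoot.of (X ^ c : k[X]) a * varpi c ^ i := by
        rw [← C_mul_X_pow_eq_monomial, map_mul, map_pow, AdjoinRoot.mk_C, AdjoinRoot.mk_X]
      have hσ : conjHom c (mk c (monomial i a)) = algebraMap k (Trunc k c) ((-1) ^ i) * mk c (monomial i a) := by
        rw [hm, map_mul, map_pow, conjHom_of, conjHom_varpi, neg_pow, map_pow, map_neg, map_one]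
        ring
      rw [hσ, coeffAt_algebraMap_mul, coeffAt_mk_of_lt c _ (sub_one_lt c hc), coeff_monomial]
      by_cases hi : i = c - 1
      · rw [if_pos hi, hi]
      · rw [if_neg hi, mul_zero, mul_zero]

/-- **`ψ̃ ∘ σ = ψ̃ ∘ ((−1)^{c−1} ·)`** (`c > 0`). -/
theorem psiTilde_conj (hc : 0 < c) (ψ₀ : AddChar k ℂ) (x : Trunc k c) :
    psiTilde c ψ₀ (conj c x) = psiTilde c ψ₀ ((-1 : Trunc k c) ^ (c - 1) * x) := by
  rw [psiTilde_apply, psiTilde_apply, conj_apply, coeffAt_conjHom c hc,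
    show (-1 : Trunc k c) ^ (c - 1) = algebraMap k (Trunc k c) ((-1) ^ (c - 1)) by
      rw [map_pow, map_neg, map_one],
    coeffAt_algebraMap_mul]

/-- **The hypothesis `hψ` of `conjDual_ramified`** (`OcticCMPointConjDual.lean`) for `n ≡ c (mod 2)`
(`n = ν + c`, `ν` even): `ψ̃(σ x) = ψ̃((−1)^{n+1} x)`. -/
theorem psiTilde_conj_pow (hc : 0 < c) (ψ₀ : AddChar k ℂ) (n : ℕ) (hn : n % 2 = c % 2) (x : Trunc k c) :
    psiTilde c ψ₀ (conj c x) = psiTilde c ψ₀ ((-1 : Trunc k c) ^ (n + 1) * x) := by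
  rw [psiTilde_conj c hc, neg_one_pow_eq_pow_mod_two (R := Trunc k c) (n := c - 1),
    neg_one_pow_eq_pow_mod_two (R := Trunc k c) (n := n + 1), show (c - 1) % 2 = (n + 1) % 2 by omega]

/-! ### Cardinality -/

/-- `k[ϖ]/(ϖ^c)` is finite when `k` is (basis `1, ϖ, …, ϖ^{c−1}`). -/
instance instFintypeTrunc [Fintype k] : Fintype (Trunc k c) :=
  Module.fintypeOfFintype (AdjoinRoot.powerBasis' (monic_X_pow c)).basis

/-- `|k[ϖ]/(ϖ^c)| = |k|^c`. -/
theorem card_trunc [Fintype k] : Fintype.card (Trunc k c) = Fintype.card k ^ c := by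
  rw [Module.card_fintype (AdjoinRoot.powerBasis' (monic_X_pow c)).basis, Fintype.card_fin,
    AdjoinRoot.powerBasis'_dim, natDegree_X_pow]

/-- `5` is prime (so that `ZMod 5 = 𝔽₅` is a field). -/
instance fact_prime_five : Fact (Nat.Prime 5) := ⟨by norm_num⟩

/-- `|𝒪/𝔭^c| = 5^c = q_K^c` at `𝔭₁, 𝔭₂ | 5` (`octic_p1.qK = octic_p2.qK = 5`; faithful for `c ≤ 4`). -/
theorem card_trunc_p5 : Fintype.card (Trunc (ZMod 5) c) = octic_p1.qK ^ c ∧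
    Fintype.card (Trunc (ZMod 5) c) = octic_p2.qK ^ c := by
  rw [card_trunc, ZMod.card]
  exact ⟨rfl, rfl⟩

/-! ### (E3) by stability on the transcribed ring -/

/-- The ideal `I = (ϖ^m)` has square zero when `2m ≥ c` (the twist's `I = 𝔭^{⌈c/2⌉}/𝔭^c`): the hypothesis `hI`
of `eps_mul_eq` / `eps_E3_of_N2` (`PeriodCloserC7Stability.lean`). -/
theorem pow_mul_eq_zero_of_le (m : ℕ) (hm : c ≤ 2 * m) :
    ∀ z ∈ Ideal.span {(varpi c : Trunc k c) ^ m}, ∀ z' ∈ Ideal.span {(varpi c : Trunc k c) ^ m}, z * z' = 0 := by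
  intro z hz z' hz'
  obtain ⟨y, rfl⟩ := Ideal.mem_span_singleton.1 hz
  obtain ⟨y', rfl⟩ := Ideal.mem_span_singleton.1 hz'
  have h : (varpi c : Trunc k c) ^ m * varpi c ^ m = 0 := by
    rw [← pow_add, show m + m = c + (2 * m - c) by omega, pow_add, varpi_pow_c, zero_mul]
  calc varpi c ^ m * y * (varpi c ^ m * y') = varpi c ^ m * varpi c ^ m * (y * y') := by ring
    _ = 0 := by rw [h, zero_mul]

/-- **(E3) at `𝔭 | 5` for the four lines twisted by one `ρ`, from N2, on the transcribed ring** (ROUTE-B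
§9.9 (d); gen 1's `eps_E3_of_N2` with `I = (ϖ^m)`, `2m ≥ c`): for a twist `ρ` primitive on `I` and shallow
`χ′_j`, `χ′₀χ′₁ = χ′₂χ′₃` gives `ε(χ′₀ρ) ε(χ′₁ρ) = ε(χ′₂ρ) ε(χ′₃ρ)`. -/
theorem E3_of_N2_trunc [Fintype k] (κ : ℂ) (n : ℕ) (χ' : Fin 4 → LocalChar (Trunc k c))
    (ρ : LocalChar (Trunc k c)) (ψ₀ : AddChar k ℂ) (m : ℕ) (hm : c ≤ 2 * m) (a : (Trunc k c)ˣ)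
    (hρ : LocalChar.Primitive (psiTilde c ψ₀) (Ideal.span {(varpi c : Trunc k c) ^ m}) ρ a)
    (hχ : ∀ j, LocalChar.Shallow (psiTilde c ψ₀) (Ideal.span {(varpi c : Trunc k c) ^ m}) (χ' j))
    (hN2 : χ' 0 * χ' 1 = χ' 2 * χ' 3) :
    LocalChar.eps κ n (χ' 0 * ρ) (psiTilde c ψ₀) * LocalChar.eps κ n (χ' 1 * ρ) (psiTilde c ψ₀) =
      LocalChar.eps κ n (χ' 2 * ρ) (psiTilde c ψ₀) * LocalChar.eps κ n (χ' 3 * ρ) (psiTilde c ψ₀) :=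
  LocalChar.eps_E3_of_N2 κ n χ' ρ (psiTilde c ψ₀) _ (pow_mul_eq_zero_of_le c m hm) a hρ hχ hN2

end TruncModel

end Summit.Ventures.HodgeRepro.PeriodCloser

end
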